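import Literature.NumberTheory.LFunctions.XiMoments

/-!
# Route `JensenPolynomials`, FAR crux `XiWindowZeroFreeRelFar` (B1-rel far, `M ≥ 2·10¹⁸`) — the OBJECTS of the line
«far-gumbel» (RH-FREE; cell rh-jensen, HUMAN RULING D-0040)

Theory g8's registered skeleton `Lines/far-gumbel.lean` v3 (sha16 `69a41b651df70375`, stubs registered on item
`stmt-RiemannHypothesis-19465` 2026-08-26T12:16:19Z; HOME `rh-jensen-theory/g8/lines/line-far-gumbel.lean`) cuts the crux
into six stubs S0–S5 whose signatures mention the objects below. This file is the «## The objects» section of that skeleton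
VERBATIM (same names, same bodies), moved under `Theorems` so that every stub prover (S1/S3 eng-4 g3, S2 eng g5, S4 eng-5 g3,
S5 open, S0 eng-2 g2 landed p444719) imports ONE copy and the registered signatures elaborate identically:

* `cM M = μ_{2M}/μ_{2M−2}`, `winI M s` (the kernel integral `μ_{2M}F_M(s)`, right side of `WindowEGF.integralRepr`),
  `farA M s = s·c_M/(M−½)`;
* `farLam υ = πe^{4υ}` (`= M/(2υ) + 9/4` at the far mode `4πe^{4υ}υ = 2M + 9υ`, which is INLINED in every stub, no `Prop`);
* `winJ M υ a = ∫_{υ−2}^∞ Φ(u)·u·(u² + a)^{M−½} du` (principal power), `farL0`, `farW z = (1+z)⁻¹`,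
  `farF w ε ξ = (2/ε)Log(1 + w(εξ/2 + ε²ξ²/16)) − e^ξ` (the Gumbel phase per unit `Λ`),
  `farXi0 w ε = Log w·(1 + ε(1/4 − w/2))` (the explicit approximate saddle), `farMain` (the Laplace value at `ξ₀`),
  `farEnv` (junk envelope), `farCubic` (closed-form cubic).

Nothing is asserted here (definitions only). WHAT THIS IS NOT: names for explicit real/complex numbers attached to `ξ`'s
Taylor data and the kernel `Φ`; nothing here bears on the zeros of `ζ` or the truth of RH.
References: GORZ 2019 [GORZPNAS2019]; Griffin–Ono–Rolen–Thorner–Tripp–Wagner 2022 §2 [GriffinEtAl2022]; theory g8's line card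
(item evidence `line-far-gumbel.md`).
-/

noncomputable section
-- D-0017: `Summit.RiemannHypothesis.RiemannHypothesis.…` duplicates the namespace BY DESIGN (single-problem summit).
set_option linter.dupNamespace false

namespace Summit.RiemannHypothesis.RiemannHypothesis.Theorems.JensenPolynomials.FarGumbel

open Literature.NumberTheory.LFunctions MeasureTheory

/-! ## The objects -/

/-- `c_M = μ_{2M}/μ_{2M−2}`. -/
def cM (M : ℕ) : ℝ := xiMoment (2 * M) / xiMoment (2 * M - 2)

/-- The kernel integral `I(M,s) = μ_{2M}·F_M(s)` (right side of g7's `integralRepr`, verbatim). -/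
def winI (M : ℕ) (s : ℂ) : ℂ :=
  ∫ u in Set.Ioi (0 : ℝ), ((deBruijnPhi u * u ^ (2 * M) : ℝ) : ℂ) *
    ∑ k ∈ Finset.range (M + 1),
      ((((descPochhammer ℝ k).eval ((M : ℝ) - 1 / 2) / (Nat.factorial k : ℝ) : ℝ)) : ℂ) *
        (s * (((xiMoment (2 * M) / xiMoment (2 * M - 2) : ℝ)) : ℂ) /
          (((((M : ℝ) - 1 / 2 : ℝ)) : ℂ) * (u : ℂ) ^ 2)) ^ k

/-- `a = s·c_M/(M−½)`, the natural variable of the kernel integral (`T_M(a/u²)`). -/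
def farA (M : ℕ) (s : ℂ) : ℂ := s * ((cM M : ℝ) : ℂ) / ((((M : ℝ) - 1 / 2 : ℝ)) : ℂ)

/- THE FAR MODE (inlined in every statement, no `def : Prop`): `υ ≥ 189/20 = 9.45` with `4πe^{4υ}υ = 2M + 9υ`
(the mode of `e^{9u − πe^{4u}}u^{2M}`; `υ(2·10¹⁸) = 9.512`; `ε := 1/υ ≤ 0.1059`). -/

/-- `Λ = πe^{4υ}` (`= M/(2υ) + 9/4` at the far mode). -/
def farLam (υ : ℝ) : ℝ := Real.pi * Real.exp (4 * υ)

/-- THE MAIN PART `J(M,υ,a) = ∫_{υ−2}^∞ Φ(u)·u·(u² + a)^{M−½} du` (principal power; `Re(u²+a) > 0` there). -/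
def winJ (M : ℕ) (υ : ℝ) (a : ℂ) : ℂ :=
  ∫ u in Set.Ioi (υ - 2), ((deBruijnPhi u * u : ℝ) : ℂ) * (((u : ℂ) ^ 2 + a) ^ ((M : ℂ) - 1 / 2))

/-- `L₀ = log(π²e^{9υ}υ^{2M}/2) − Λ + ½log(2π/Λ)`: the Laplace value of `log J` at `a = 0`. -/
def farL0 (M : ℕ) (υ : ℝ) : ℝ :=
  Real.log (Real.pi ^ 2 / 2 * Real.exp (9 * υ) * υ ^ (2 * M)) - farLam υ +
    1 / 2 * Real.log (2 * Real.pi / farLam υ)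

/-- `w = 1/(1+z̃)`. -/
def farW (z : ℂ) : ℂ := (1 + z)⁻¹

/-- THE GUMBEL PHASE per unit `Λ`: `f(ξ; w, ε) = (2/ε)·Log(1 + w(εξ/2 + ε²ξ²/16)) − e^ξ` (`ε = 0` limit: the Gamma phase
`wξ − e^ξ`).  With `u = υ + ξ/4`: `(u² + a)^{M−½} = υ^{2M−1}(1+z̃)^{M−½}(1 + w(εξ/2 + ε²ξ²/16))^{M−½}`, `πe^{4u} = Λe^ξ`, and the
mode equation `Λ = (M−½)ε/2 + ε/4 + 9/4` make the full phase `Λ·f(ξ;w,ε) + O(1)`. -/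
def farF (w : ℂ) (ε : ℝ) (ξ : ℂ) : ℂ :=
  (2 / ε : ℝ) * Complex.log (1 + w * ((ε : ℂ) * ξ / 2 + (ε : ℂ) ^ 2 * ξ ^ 2 / 16)) - Complex.exp ξ

/-- THE EXPLICIT APPROXIMATE SADDLE `ξ₀(w, ε) = Log w · (1 + ε(1/4 − w/2))` (`f′(ξ₀) = O(wε²)`: `|f′(ξ₀)| ≤ 0.26ε²`,
`|f(ξ_s) − f(ξ₀)| ≤ 0.02ε⁴` on `|z̃| ≤ 0.36`; `|Im ξ₀| ≤ 0.369` ⇒ contour height `|Im u| ≤ 0.093 < π/8`; `Re f″(ξ₀) ≤ −0.735`;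
design point of eng-4 g3, S 11:50:13Z). -/
def farXi0 (w : ℂ) (ε : ℝ) : ℂ := Complex.log w * (1 + (ε : ℂ) * (1 / 4 - w / 2))

/-- THE LAPLACE VALUE AT THE APPROXIMATE SADDLE
`farMain = L₀ + (M−½)log|1+z̃| + Λ·(Re f(ξ₀(w,ε); w, ε) + 1) − ½log|w|`, `ε = 1/υ`, `w = 1/(1+z̃)`. -/
def farMain (M : ℕ) (υ : ℝ) (z : ℂ) : ℝ :=
  farL0 M υ + ((M : ℝ) - 1 / 2) * Real.log ‖1 + z‖ +
    farLam υ * ((farF (farW z) (1 / υ) (farXi0 (farW z) (1 / υ))).re + 1) - 1 / 2 * Real.log ‖farW z‖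

/-- THE JUNK ENVELOPE `Env = e^{L₀}·|1+z̃|^{M−½}·e^{−Λ/8}` (`≤ e^{−Λ/75}·|J|` by `stub_elementary` (i) + `stub_laplaceFar`). -/
def farEnv (M : ℕ) (υ : ℝ) (z : ℂ) : ℝ :=
  Real.exp (farL0 M υ) * ‖1 + z‖ ^ ((M : ℝ) - 1 / 2) * Real.exp (-farLam υ / 8)

/-- THE CLOSED-FORM CUBIC `(M−½)·Re(z̃ + c₂z̃² + c₃z̃³)`, `c₂ = −1/2 + ε/4 − ε²/16`, `c₃ = 1/3 − 5ε/12 + ε²/4` (`ε = 1/υ`):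
the Taylor cubic of `Log(1+z̃) + (ε/2)(H₀(w)+1+εH₁(w))`, `H₀ + 1 = w Log w − w + 1`, `H₁ = (w/8 − w²/4)(Log w)²` = the two-term
expansion of the critical value `f(ξ_s) = H₀ + εH₁ + O(0.058ε²)`. -/
def farCubic (M : ℕ) (υ : ℝ) (z : ℂ) : ℝ :=
  ((M : ℝ) - 1 / 2) *
    (z + (((-1 / 2 + 1 / (4 * υ) - 1 / (16 * υ ^ 2) : ℝ)) : ℂ) * z ^ 2 +
      (((1 / 3 - 5 / (12 * υ) + 1 / (4 * υ ^ 2) : ℝ)) : ℂ) * z ^ 3).re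


end Summit.RiemannHypothesis.RiemannHypothesis.Theorems.JensenPolynomials.FarGumbel

end
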